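import Summits.BirchSwinnertonDyer.Rank1Residual.X11b.SemistableRecords
import Summits.BirchSwinnertonDyer.Rank1Residual.X11b.SemistableRecordsCards1
import Summits.BirchSwinnertonDyer.Rank1Residual.X11b.SemistableRecordsCards2
import Summits.BirchSwinnertonDyer.BirchSwinnertonDyer.Theorems.Rank1ResidualX11RankOneReduction
import HarnessLib

/-!
# BSD rank-≤1 residual cell, class X11b ∧ r = 1 ∧ p ≥ 5, the 58 SEMISTABLE in-window pairs: the
# FINITE conjuncts of their records — global minimality, `Mult`, split type, (ram), `Irr`, `p` prime,
# `Δ ≠ 0` — are KERNEL THEOREMS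

HONEST FRAMING (cell `b2b-bsdres-*`, verbatim): prove what is provable now; shrink each hard class
to its core with data; no claim beyond stated classes; COMBINATION classes deleted from PUBLISHED
theorems only, CONSTRUCTION-shaped remainder typed; this is not "finishing BSD". Class X11b stays
CONSTRUCTION-SHAPED; everything here is PER PAIR; no lane verdict is changed; no named fact.

Unit `b2b-bsdres-x11c`, gen 9. Theorems only. For every record `r` of `sstRecords1 ++ sstRecords2`
(`X11b/SemistableRecords.lean`), from kernel-decided integer certificates and the generic
integer-model lemmas of `Rank1ResidualIntModelReduction.lean` / `Rank1ResidualX11RankOneMinimality.lean`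
(unit x11c gen 2, used verbatim by name — the same pipeline as the 85 non-semistable records):

* `krausCriterionSst_all` (`decide`): five a-invariants, `Δ ≠ 0`, `|Δ| < 512¹²`, and Silverman's criterion
  `q¹² ∤ Δ ∨ q⁴ ∤ c₄` at every `q < 512` (AEC VII.1 Rem. 1.1 — on a semistable curve no Kraus pattern is
  needed: `c₄` is a unit at every multiplicative prime) ⟹ `isGloballyMinimal_curve_of_mem_sst`;
* `reductionCertSst_all` (`decide`): `p` prime (trial division) and `≥ 5`; `p ∣ Δ`, `p ∤ c₄`; a root /
  no root `t < p` of the node-tangent quadratic mod `p` according to `split`; a (ram) witness `ℓ ≠ p` in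
  `bad` with `ℓ ∣ Δ`, `ℓ ∤ c₄`, `ℓᵉ ‖ Δ`, `p ∤ e` (every one of the 58 has one); `p ∤ shaAn`;
* `irrCertSst_all`: a good odd prime `ℓ ≠ p` with the kernel-decided point count `#Ẽ(𝔽_ℓ) = n`
  (`SemistableRecordsCards{1,2}.lean`) and `X² − (ℓ + 1 − n)X + ℓ` root-free mod `p` (decided);
* `reduction_of_mem_sst`: hence IN THE KERNEL `Mult r.curve r.p`, the split / non-split type as
  recorded, `Ram r.curve r.p`, `Irr r.curve r.p` (Mazur 1978 Prop. 6.3 (1)); and the instance facts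
  `Fact r.p.Prime`, `r.curve.IsElliptic`, `r.curve.IsGloballyMinimal`.

What is left as a genuine hypothesis per pair (file `SemistableRecordsFinal.lean`): analytic rank `= 1`,
`#Ш_an = 1`, and the two-engine `p`-adic valuation identity (`CertSplit` / `CertNonsplit`).

References: J. H. Silverman, *AEC* (2009) VII.1 Rem. 1.1, VII.5 Prop. 5.1 [SilvermanAEC2009]; B. Mazur,
Invent. Math. 44 (1978) Prop. 6.3 (1) [Mazur1978]; Skinner–Urban 2014 Thm. 2 ((ram)) [SkinnerUrban2014];
Cremona's tables [Cremona2006].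
-/

set_option autoImplicit false

open scoped Classical

open WeierstrassCurve Literature.NumberTheory.EllipticCurves
  Literature.NumberTheory.EllipticCurves.Rank1Residual
  Literature.NumberTheory.EllipticCurves.Rank1Residual.X11RankOneCertificates
  Summit.BirchSwinnertonDyer.BirchSwinnertonDyer.Rank1Residual.IntModel
  Summit.BirchSwinnertonDyer.BirchSwinnertonDyer.Rank1Residual.X11RankOne

namespace Summit.BirchSwinnertonDyer.Rank1Residual.X11b

/-! ### §1. Global minimality: Silverman's criterion at every prime, decided -/

-- `decide` evaluates `discOf`/`c4Of`/`c6Of` per record and trial-divides below `512`.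
set_option maxRecDepth 100000 in
/-- **Every one of the 58 semistable records satisfies the bounded Silverman/Kraus criterion** (kernel-
evaluated; in fact the Silverman disjuncts `q¹² ∤ |Δ|` / `q⁴ ∤ |c₄|` alone, the Kraus patterns being
vacuous here) — the statement is verbatim the one of `krausCriterion_all` for the 85. [folklore] -/
theorem krausCriterionSst_all : ∀ r ∈ sstRecords1 ++ sstRecords2,
    r.ainvs.length = 5 ∧ discOf r.ainvs ≠ 0 ∧ (discOf r.ainvs).natAbs < 512 ^ 12 ∧
    ∀ q < 512, q < 2 ∨ ¬ q ^ 12 ∣ (discOf r.ainvs).natAbs ∨ ¬ q ^ 4 ∣ (c4Of r.ainvs).natAbs ∨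
      (q = 2 ∧ ¬ (2 : ℤ) ^ 8 ∣ c4Of r.ainvs ∧ (2 : ℤ) ^ 7 ∣ c6Of r.ainvs) ∨
      (q = 2 ∧ ¬ (2 : ℤ) ^ 24 ∣ discOf r.ainvs ∧ (512 : ℤ) ∣ c6Of r.ainvs ∧
        (4 : ℤ) ∣ c6Of r.ainvs / 512 - 3) ∨
      (q = 3 ∧ (3 : ℤ) ^ 8 ∣ c6Of r.ainvs ∧ ¬ (3 : ℤ) ^ 9 ∣ c6Of r.ainvs) := by
  decide +kernel

/-- **The Cremona model of every one of the 58 semistable records is globally minimal** — decided in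
the kernel. [cite: SilvermanAEC2009, VII.1 Remark 1.1 and VIII.8] -/
theorem isGloballyMinimal_curve_of_mem_sst (r : Record) (hr : r ∈ sstRecords1 ++ sstRecords2) :
    r.curve.IsGloballyMinimal := by
  obtain ⟨hlen, h0, hB, h⟩ := krausCriterionSst_all r hr
  rcases hA : r.ainvs with _ | ⟨a1, _ | ⟨a2, _ | ⟨a3, _ | ⟨a4, _ | ⟨a6, _ | ⟨x, t⟩⟩⟩⟩⟩⟩ <;>
    simp [hA] at hlen
  rw [Record.curve_of_eq hA]
  rw [hA] at h0 hB h
  exact isGloballyMinimal_of_krausCriterion_bounded a1 a2 a3 a4 a6 h0 hB h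

/-- Every record's curve is an elliptic curve (`Δ(ainvs) ≠ 0`, five a-invariants). [folklore] -/
theorem isElliptic_curve_of_mem_sst (r : Record) (hr : r ∈ sstRecords1 ++ sstRecords2) :
    r.curve.IsElliptic := by
  obtain ⟨hlen, h0, -, -⟩ := krausCriterionSst_all r hr
  rcases hA : r.ainvs with _ | ⟨a1, _ | ⟨a2, _ | ⟨a3, _ | ⟨a4, _ | ⟨a6, _ | ⟨x, t⟩⟩⟩⟩⟩⟩ <;>
    simp [hA] at hlen
  refine ⟨?_⟩
  rw [Record.Δ_curve_of_eq hA, isUnit_iff_ne_zero]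
  rw [hA] at h0
  exact_mod_cast h0

/-! ### §2. The decidable reduction certificates of all 58 records -/

-- `decide` recomputes `Δ`, `c₄`, `b₂`, `b₄`, `b₆` per record and searches `t < p ≤ 11`.
set_option maxRecDepth 100000 in
/-- **Reduction certificates, all 58 semistable records** (kernel-evaluated): `p` prime by trial division
and `5 ≤ p`; `p ∣ Δ ∧ p ∤ c₄`; a root (split) / no root (non-split) `t < p` of the node-tangent quadratic
mod `p`; a (ram) witness in `bad`; `p ∤ shaAn`. [folklore] -/
theorem reductionCertSst_all : ∀ r ∈ sstRecords1 ++ sstRecords2,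
    (isPrimeBelow504100 r.p = true ∧ 5 ≤ r.p ∧ ¬ r.p ∣ r.shaAn) ∧
    ((r.p : ℤ) ∣ discOf r.ainvs ∧ ¬ (r.p : ℤ) ∣ c4Of r.ainvs) ∧
    (r.split = true → ∃ t : ℕ, t < r.p ∧ (r.p : ℤ) ∣ c4Of r.ainvs * (t : ℤ) ^ 2 + r.ainvs.getD 0 0 * c4Of r.ainvs * t
        - (54 * (invariants r.ainvs).2.2.1 - 3 * (invariants r.ainvs).1 * (invariants r.ainvs).2.1
          + r.ainvs.getD 1 0 * c4Of r.ainvs)) ∧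
    (r.split = false → ∀ t : ℕ, t < r.p → ¬ (r.p : ℤ) ∣ c4Of r.ainvs * (t : ℤ) ^ 2 + r.ainvs.getD 0 0 * c4Of r.ainvs * t
        - (54 * (invariants r.ainvs).2.2.1 - 3 * (invariants r.ainvs).1 * (invariants r.ainvs).2.1
          + r.ainvs.getD 1 0 * c4Of r.ainvs)) ∧
    (∃ b ∈ r.bad, isPrimeBelow504100 b.1 = true ∧ b.1 ≠ r.p ∧ (b.1 : ℤ) ∣ discOf r.ainvs ∧
      ¬ (b.1 : ℤ) ∣ c4Of r.ainvs ∧ (b.1 : ℤ) ^ b.2.2 ∣ discOf r.ainvs ∧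
      ¬ (b.1 : ℤ) ^ (b.2.2 + 1) ∣ discOf r.ainvs ∧ ¬ r.p ∣ b.2.2) := by
  decide +kernel

/-! ### §3. The Frobenius witnesses for `Irr`, all 58 records -/

/-- **`Irr` certificates, all 58 semistable records**: a witness prime `ℓ` (prime by trial division,
`ℓ ≠ p`, `ℓ ∤ Δ`), the kernel-decided point count `#Ẽ(𝔽_ℓ) = n` of `SemistableRecordsCards{1,2}`, and
root-freeness of `X² − (ℓ + 1 − n)X + ℓ` modulo `p` (decided). [cite: Mazur1978, §6 Prop. 6.3 (1) (p. 153)] -/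
theorem irrCertSst_all : ∀ r ∈ sstRecords1 ++ sstRecords2,
    ∃ ℓ n : ℕ, isPrimeBelow504100 ℓ = true ∧ ℓ ≠ r.p ∧ ¬ (ℓ : ℤ) ∣ discOf r.ainvs ∧
      (∀ t : ℕ, t < r.p → ¬ (r.p : ℤ) ∣ (t : ℤ) ^ 2 - ((ℓ : ℤ) + 1 - n) * t + ℓ) ∧
      (match r.ainvs with
        | [a1, a2, a3, a4, a6] =>
          Nat.card (((⟨a1, a2, a3, a4, a6⟩ : WeierstrassCurve ℤ).map
            (Int.castRingHom (ZMod ℓ))).toAffine.Point) = n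
        | _ => False) := by
  refine List.forall_mem_cons.mpr ⟨?_, ?_⟩
  · exact ⟨3, 6, by decide +kernel, by decide, by decide +kernel, by decide +kernel, card_s430d1_3⟩
  refine List.forall_mem_cons.mpr ⟨?_, ?_⟩
  · exact ⟨13, 18, by decide +kernel, by decide, by decide +kernel, by decide +kernel, card_s1155k1_13⟩
  refine List.forall_mem_cons.mpr ⟨?_, ?_⟩
  · exact ⟨7, 8, by decide +kernel, by decide, by decide +kernel, by decide +kernel, card_s1590i1_7⟩
  refine List.forall_mem_cons.mpr ⟨?_, ?_⟩
  · exact ⟨3, 7, by decide +kernel, by decide, by decide +kernel, by decide +kernel, card_s2990g1_3⟩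
  refine List.forall_mem_cons.mpr ⟨?_, ?_⟩
  · exact ⟨13, 17, by decide +kernel, by decide, by decide +kernel, by decide +kernel, card_s3030u1_13⟩
  refine List.forall_mem_cons.mpr ⟨?_, ?_⟩
  · exact ⟨13, 14, by decide +kernel, by decide, by decide +kernel, by decide +kernel, card_s3045j1_13⟩
  refine List.forall_mem_cons.mpr ⟨?_, ?_⟩
  · exact ⟨17, 24, by decide +kernel, by decide, by decide +kernel, by decide +kernel, card_s4830y1_17⟩
  refine List.forall_mem_cons.mpr ⟨?_, ?_⟩
  · exact ⟨7, 13, by decide +kernel, by decide, by decide +kernel, by decide +kernel, card_s6045f1_7⟩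
  refine List.forall_mem_cons.mpr ⟨?_, ?_⟩
  · exact ⟨3, 4, by decide +kernel, by decide, by decide +kernel, by decide +kernel, card_s6310e1_3⟩
  refine List.forall_mem_cons.mpr ⟨?_, ?_⟩
  · exact ⟨11, 13, by decide +kernel, by decide, by decide +kernel, by decide +kernel, card_s6342m1_11⟩
  refine List.forall_mem_cons.mpr ⟨?_, ?_⟩
  · exact ⟨11, 18, by decide +kernel, by decide, by decide +kernel, by decide +kernel, card_s6510bb1_11⟩
  refine List.forall_mem_cons.mpr ⟨?_, ?_⟩
  · exact ⟨11, 18, by decide +kernel, by decide, by decide +kernel, by decide +kernel, card_s6510x1_11⟩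
  refine List.forall_mem_cons.mpr ⟨?_, ?_⟩
  · exact ⟨31, 23, by decide +kernel, by decide, by decide +kernel, by decide +kernel, card_s6630h1_31⟩
  refine List.forall_mem_cons.mpr ⟨?_, ?_⟩
  · exact ⟨11, 8, by decide +kernel, by decide, by decide +kernel, by decide +kernel, card_s6990n1_11⟩
  refine List.forall_mem_cons.mpr ⟨?_, ?_⟩
  · exact ⟨7, 8, by decide +kernel, by decide, by decide +kernel, by decide +kernel, card_s6990o1_7⟩
  refine List.forall_mem_cons.mpr ⟨?_, ?_⟩
  · exact ⟨3, 6, by decide +kernel, by decide, by decide +kernel, by decide +kernel, card_s7259d1_3⟩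
  refine List.forall_mem_cons.mpr ⟨?_, ?_⟩
  · exact ⟨7, 7, by decide +kernel, by decide, by decide +kernel, by decide +kernel, card_s7755i1_7⟩
  refine List.forall_mem_cons.mpr ⟨?_, ?_⟩
  · exact ⟨13, 14, by decide +kernel, by decide, by decide +kernel, by decide +kernel, card_s7770bc1_13⟩
  refine List.forall_mem_cons.mpr ⟨?_, ?_⟩
  · exact ⟨7, 8, by decide +kernel, by decide, by decide +kernel, by decide +kernel, card_s8430h1_7⟩
  refine List.forall_mem_cons.mpr ⟨?_, ?_⟩
  · exact ⟨13, 12, by decide +kernel, by decide, by decide +kernel, by decide +kernel, card_s8610h1_13⟩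
  refine List.forall_mem_cons.mpr ⟨?_, ?_⟩
  · exact ⟨7, 8, by decide +kernel, by decide, by decide +kernel, by decide +kernel, card_s8790h1_7⟩
  refine List.forall_mem_cons.mpr ⟨?_, ?_⟩
  · exact ⟨7, 4, by decide +kernel, by decide, by decide +kernel, by decide +kernel, card_s8870b1_7⟩
  refine List.forall_mem_cons.mpr ⟨?_, ?_⟩
  · exact ⟨11, 16, by decide +kernel, by decide, by decide +kernel, by decide +kernel, card_s9345f1_11⟩
  refine List.forall_mem_cons.mpr ⟨?_, ?_⟩
  · exact ⟨7, 7, by decide +kernel, by decide, by decide +kernel, by decide +kernel, card_s9570s1_7⟩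
  refine List.forall_mem_cons.mpr ⟨?_, ?_⟩
  · exact ⟨13, 17, by decide +kernel, by decide, by decide +kernel, by decide +kernel, card_s9930q1_13⟩
  refine List.forall_mem_cons.mpr ⟨?_, ?_⟩
  · exact ⟨11, 16, by decide +kernel, by decide, by decide +kernel, by decide +kernel, card_s11130bc1_11⟩
  refine List.forall_mem_cons.mpr ⟨?_, ?_⟩
  · exact ⟨11, 16, by decide +kernel, by decide, by decide +kernel, by decide +kernel, card_s11130d1_11⟩
  refine List.forall_mem_cons.mpr ⟨?_, ?_⟩
  · exact ⟨3, 2, by decide +kernel, by decide, by decide +kernel, by decide +kernel, card_s11305d1_3⟩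
  refine List.forall_mem_cons.mpr ⟨?_, ?_⟩
  · exact ⟨3, 6, by decide +kernel, by decide, by decide +kernel, by decide +kernel, card_s11590f1_3⟩
  refine List.forall_mem_cons.mpr ⟨?_, ?_⟩
  · exact ⟨13, 16, by decide +kernel, by decide, by decide +kernel, by decide +kernel, card_s12110d1_13⟩
  refine List.forall_mem_cons.mpr ⟨?_, ?_⟩
  · exact ⟨29, 38, by decide +kernel, by decide, by decide +kernel, by decide +kernel, card_s12210q1_29⟩
  refine List.forall_mem_cons.mpr ⟨?_, ?_⟩
  · exact ⟨7, 7, by decide +kernel, by decide, by decide +kernel, by decide +kernel, card_s12630h1_7⟩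
  refine List.forall_mem_cons.mpr ⟨?_, ?_⟩
  · exact ⟨7, 7, by decide +kernel, by decide, by decide +kernel, by decide +kernel, card_s13035f1_7⟩
  refine List.forall_mem_cons.mpr ⟨?_, ?_⟩
  · exact ⟨5, 8, by decide +kernel, by decide, by decide +kernel, by decide +kernel, card_s13398bk1_5⟩
  refine List.forall_mem_cons.mpr ⟨?_, ?_⟩
  · exact ⟨7, 8, by decide +kernel, by decide, by decide +kernel, by decide +kernel, card_s13830h1_7⟩
  refine List.forall_mem_cons.mpr ⟨?_, ?_⟩
  · exact ⟨7, 7, by decide +kernel, by decide, by decide +kernel, by decide +kernel, card_s13970m1_7⟩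
  refine List.forall_mem_cons.mpr ⟨?_, ?_⟩
  · exact ⟨7, 8, by decide +kernel, by decide, by decide +kernel, by decide +kernel, card_s14010e1_7⟩
  refine List.forall_mem_cons.mpr ⟨?_, ?_⟩
  · exact ⟨7, 12, by decide +kernel, by decide, by decide +kernel, by decide +kernel, card_s14430ba1_7⟩
  refine List.forall_mem_cons.mpr ⟨?_, ?_⟩
  · exact ⟨7, 4, by decide +kernel, by decide, by decide +kernel, by decide +kernel, card_s14835f1_7⟩
  refine List.forall_mem_cons.mpr ⟨?_, ?_⟩
  · exact ⟨17, 22, by decide +kernel, by decide, by decide +kernel, by decide +kernel, card_s15015k1_17⟩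
  refine List.forall_mem_cons.mpr ⟨?_, ?_⟩
  · exact ⟨3, 2, by decide +kernel, by decide, by decide +kernel, by decide +kernel, card_s16030c1_3⟩
  refine List.forall_mem_cons.mpr ⟨?_, ?_⟩
  · exact ⟨5, 2, by decide +kernel, by decide, by decide +kernel, by decide +kernel, card_s16082a1_5⟩
  refine List.forall_mem_cons.mpr ⟨?_, ?_⟩
  · exact ⟨3, 2, by decide +kernel, by decide, by decide +kernel, by decide +kernel, card_s16390q1_3⟩
  refine List.forall_mem_cons.mpr ⟨?_, ?_⟩
  · exact ⟨3, 3, by decide +kernel, by decide, by decide +kernel, by decide +kernel, card_s16730i1_3⟩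
  refine List.forall_mem_cons.mpr ⟨?_, ?_⟩
  · exact ⟨3, 7, by decide +kernel, by decide, by decide +kernel, by decide +kernel, card_s16910c1_3⟩
  refine List.forall_mem_cons.mpr ⟨?_, ?_⟩
  · exact ⟨23, 21, by decide +kernel, by decide, by decide +kernel, by decide +kernel, card_s17130s1_23⟩
  refine List.forall_mem_cons.mpr ⟨?_, ?_⟩
  · exact ⟨13, 12, by decide +kernel, by decide, by decide +kernel, by decide +kernel, card_s17170m1_13⟩
  refine List.forall_mem_cons.mpr ⟨?_, ?_⟩
  · exact ⟨7, 13, by decide +kernel, by decide, by decide +kernel, by decide +kernel, card_s17170p1_7⟩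
  refine List.forall_mem_cons.mpr ⟨?_, ?_⟩
  · exact ⟨3, 6, by decide +kernel, by decide, by decide +kernel, by decide +kernel, card_s17390g1_3⟩
  refine List.forall_mem_cons.mpr ⟨?_, ?_⟩
  · exact ⟨11, 12, by decide +kernel, by decide, by decide +kernel, by decide +kernel, card_s18165j1_11⟩
  refine List.forall_mem_cons.mpr ⟨?_, ?_⟩
  · exact ⟨5, 10, by decide +kernel, by decide, by decide +kernel, by decide +kernel, card_s18354c1_5⟩
  refine List.forall_mem_cons.mpr ⟨?_, ?_⟩
  · exact ⟨5, 3, by decide +kernel, by decide, by decide +kernel, by decide +kernel, card_s18354r1_5⟩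
  refine List.forall_mem_cons.mpr ⟨?_, ?_⟩
  · exact ⟨3, 6, by decide +kernel, by decide, by decide +kernel, by decide +kernel, card_s18530j1_3⟩
  refine List.forall_mem_cons.mpr ⟨?_, ?_⟩
  · exact ⟨7, 8, by decide +kernel, by decide, by decide +kernel, by decide +kernel, card_s19065i1_7⟩
  refine List.forall_mem_cons.mpr ⟨?_, ?_⟩
  · exact ⟨7, 13, by decide +kernel, by decide, by decide +kernel, by decide +kernel, card_s19090e1_7⟩
  refine List.forall_mem_cons.mpr ⟨?_, ?_⟩
  · exact ⟨11, 8, by decide +kernel, by decide, by decide +kernel, by decide +kernel, card_s19230h1_11⟩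
  refine List.forall_mem_cons.mpr ⟨?_, ?_⟩
  · exact ⟨11, 16, by decide +kernel, by decide, by decide +kernel, by decide +kernel, card_s19290k1_11⟩
  refine List.forall_mem_cons.mpr ⟨?_, ?_⟩
  · exact ⟨3, 4, by decide +kernel, by decide, by decide +kernel, by decide +kernel, card_s19565d1_3⟩
  intro r h
  simp at h

/-! ### §4. The finite record conjuncts as kernel theorems, record by record -/

/-- A listed record's `p` is prime (trial division in the kernel). [folklore] -/
theorem prime_of_mem_sst (r : Record) (hr : r ∈ sstRecords1 ++ sstRecords2) : r.p.Prime :=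
  prime_of_isPrimeBelow504100 (reductionCertSst_all r hr).1.1

/-- A listed record has `5 ≤ p`. [folklore] -/
theorem five_le_of_mem_sst (r : Record) (hr : r ∈ sstRecords1 ++ sstRecords2) : 5 ≤ r.p :=
  (reductionCertSst_all r hr).1.2.1

/-- A listed record has `ord_p (shaAn : ℚ) = 0` (`p ∤ shaAn`; here `shaAn = 1` throughout). [folklore] -/
theorem padicValRat_shaAn_eq_zero_of_mem_sst (r : Record) (hr : r ∈ sstRecords1 ++ sstRecords2) :
    padicValRat r.p (r.shaAn : ℚ) = 0 := by
  rw [padicValRat.of_nat]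
  exact_mod_cast padicValNat.eq_zero_of_not_dvd (reductionCertSst_all r hr).1.2.2

/-- **For every one of the 58 semistable records: `Mult`, split type, (ram), `Irr` hold for the record's
curve IN THE KERNEL** (any instances; the instance facts are themselves kernel theorems,
`prime_of_mem_sst`, `isElliptic_curve_of_mem_sst`, `isGloballyMinimal_curve_of_mem_sst`).
[cite: SilvermanAEC2009, VII.5 Prop. 5.1] [cite: Mazur1978, §6 Prop. 6.3 (1) (p. 153)] -/
theorem reduction_of_mem_sst (r : Record) (hr : r ∈ sstRecords1 ++ sstRecords2)
    [Fact r.p.Prime] [r.curve.IsElliptic] [r.curve.IsGloballyMinimal] :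
    Mult r.curve r.p ∧ (r.split = true → r.curve.HasSplitMultiplicativeReductionAtPrime r.p) ∧
    (r.split = false → ¬ r.curve.HasSplitMultiplicativeReductionAtPrime r.p) ∧
    Ram r.curve r.p ∧ Irr r.curve r.p := by
  haveI : NeZero r.p := ⟨(Fact.out : r.p.Prime).ne_zero⟩
  obtain ⟨-, ⟨hpΔ, hpc4⟩, hsp, hnsp, ⟨b', -, hprime', hne', hΔ', hc4', he, he', hpe⟩⟩ := reductionCertSst_all r hr
  obtain ⟨ℓ, n, hℓprime, hℓp, hℓΔ, hnoroot, hcard⟩ := irrCertSst_all r hr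
  have hlen : r.ainvs.length = 5 := (krausCriterionSst_all r hr).1
  rcases hA : r.ainvs with _ | ⟨a1, _ | ⟨a2, _ | ⟨a3, _ | ⟨a4, _ | ⟨a6, _ | ⟨x, t⟩⟩⟩⟩⟩⟩ <;>
    simp [hA] at hlen
  rw [hA] at hpΔ hpc4 hsp hnsp hΔ' hc4' he he' hℓΔ hcard
  set E₀ : WeierstrassCurve ℤ := ⟨a1, a2, a3, a4, a6⟩ with hE₀
  have hI : integralModelInt r.curve = E₀ := integralModelInt_curve r hA
  have hΔ : E₀.Δ = discOf [a1, a2, a3, a4, a6] := intCurve_Δ a1 a2 a3 a4 a6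
  have hc4 : E₀.c₄ = c4Of [a1, a2, a3, a4, a6] := intCurve_c₄ a1 a2 a3 a4 a6
  have hb2 := intCurve_b₂ a1 a2 a3 a4 a6
  have hb4 := intCurve_b₄ a1 a2 a3 a4 a6
  have hb6 := intCurve_b₆ a1 a2 a3 a4 a6
  have hpΔ' : (r.p : ℤ) ∣ E₀.Δ := by rw [hΔ]; exact hpΔ
  have hpc4' : ¬ (r.p : ℤ) ∣ E₀.c₄ := by rw [hc4]; exact hpc4
  -- the node-tangent quadratic of `E₀` mod `p`, evaluated at `t : ℕ`, is the cast of the recheck's integer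
  have hnode : ∀ t : ℕ,
      ((E₀.c₄ : ZMod r.p) * (t : ZMod r.p) ^ 2 + (E₀.a₁ * E₀.c₄ : ZMod r.p) * (t : ZMod r.p)
        - (54 * E₀.b₆ - 3 * E₀.b₂ * E₀.b₄ + E₀.a₂ * E₀.c₄ : ZMod r.p)) =
      ((c4Of [a1, a2, a3, a4, a6] * (t : ℤ) ^ 2 + [a1, a2, a3, a4, a6].getD 0 0 * c4Of [a1, a2, a3, a4, a6] * t
        - (54 * (invariants [a1, a2, a3, a4, a6]).2.2.1
          - 3 * (invariants [a1, a2, a3, a4, a6]).1 * (invariants [a1, a2, a3, a4, a6]).2.1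
          + [a1, a2, a3, a4, a6].getD 1 0 * c4Of [a1, a2, a3, a4, a6]) : ℤ) : ZMod r.p) := by
    intro t
    rw [hc4, hb2, hb4, hb6]
    simp only [hE₀, List.getD_cons_zero, List.getD_cons_succ]
    push_cast
    ring
  refine ⟨hasMultiplicativeReductionAtPrime_of_intModel hI r.p hpΔ' hpc4', ?_, ?_, ?_, ?_⟩
  · intro hs
    obtain ⟨t, -, ht⟩ := hsp hs
    refine hasSplitMultiplicativeReductionAtPrime_of_intModel_of_root hI r.p hpΔ' hpc4' ⟨(t : ZMod r.p), ?_⟩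
    rw [hnode, ZMod.intCast_zmod_eq_zero_iff_dvd]
    exact ht
  · intro hs
    refine not_hasSplitMultiplicativeReductionAtPrime_of_intModel_of_noroot hI r.p hpΔ' hpc4'
      (forall_zmod_of_forall_lt fun t ht ↦ ?_)
    rw [hnode, Ne, ZMod.intCast_zmod_eq_zero_iff_dvd]
    exact hnsp hs t ht
  · exact ram_of_intModel hI r.p b'.1 (prime_of_isPrimeBelow504100 hprime') hne'
      (by rw [hΔ]; exact hΔ') (by rw [hc4]; exact hc4') (e := b'.2.2) (by rw [hΔ]; exact he)
      (by rw [hΔ]; exact he') hpe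
  · haveI : Fact ℓ.Prime := ⟨prime_of_isPrimeBelow504100 hℓprime⟩
    refine hasIrreducibleModPGaloisRep_of_intModel_of_noroot hI r.p ℓ hℓp (by rw [hΔ]; exact hℓΔ) hcard
      (forall_zmod_of_forall_lt fun t ht h0 ↦ hnoroot t ht ?_)
    rw [← ZMod.intCast_zmod_eq_zero_iff_dvd]
    push_cast at h0 ⊢
    linear_combination h0

end Summit.BirchSwinnertonDyer.Rank1Residual.X11b
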